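import Summits.ValiantsHypothesis.ValiantsHypothesis.Theorems.KPlusLogSqLawLiftingNewtonWindows

/-!
# EXACT archimedean Newton-polygon root count — the two-sided, pencil-level form of patchworking

HONEST FRAMING.  Helper file (part 2 of 2) toward the lifting crux `WeakLifting` (stmt-ValiantsHypothesis-19561; aside
`Lifting` stmt-ValiantsHypothesis-19772) of route `KPlusLogSqLaw` (cell `pub-symmetroid`, seat val-sym-lift-p2 g3, 2026-08-26).
A theorem about ONE real polynomial; nothing here asserts `WeakLifting`, `TropicalB`, Conjecture B, `MatrixDescartes`
(stmt-ValiantsHypothesis-18050) or anything about VP ≠ VNP.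

THEOREM (`card_posRoots_eq_card_alternating`).  Let `f = Σ_s a_s X^s` be real, `v₀ < v₁ < ⋯ < v_r` exponents of `f` with
`v₀` the least and `v_r` the largest exponent of the support (the VERTEX CHAIN), and `0 < p₀ ≤ q₀ ≤ p₁ ≤ q₁ ≤ ⋯ ≤ p_{r−1} ≤ q_{r−1}`
(the TRANSITION WINDOWS `[p_k, q_k]`, one per edge `(v_k, v_{k+1})`).  Assume, for every `k < r`,
(D) archimedean dominance of `v_k` at `p_k` and of `v_{k+1}` at `q_k`:  `Σ_{s ≠ v} |a_s| x^s < |a_v| x^v`, and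
(M) the edge margin at `p_k` and at `q_k`:  `Σ_{s ∉ {v_k, v_{k+1}}} |s − v_k| |a_s| x^s < (v_{k+1} − v_k) |a_{v_{k+1}}| x^{v_{k+1}}`.
Then the number of distinct positive zeros of `f` is EXACTLY `#{k : a_{v_k} a_{v_{k+1}} < 0}`, the number of sign-alternating
edges — the «Viro count» of the chain.  Upper half `card_posRoots_le_card_alternating` (needs (D), (M); the new direction),
lower half `card_alternating_le_card_posRoots` (needs (D) only; the intermediate value theorem, as in the tree's
`le_card_posRoots_of_alternating`).  All hypotheses are finitely many polynomial inequalities at the `2r` points `p_k, q_k`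
(a certificate shape), because convexity in `log x` transports them to the regions and windows (part 1).

WHY IT IS HERE (GAP-LIFT.md §3 of val-sym-lift-p4, mechanisms M2/M3).  For the patchworked pencil of a tropical design
(`MatrixDescartes.Negative.patchMatrix`, base `b`) whose upper envelope has unique vertex terms, the merged coefficients are
`c_s(b) = ±b^{−V_s}(1 + o(1))` on the envelope vertices and smaller by powers of `b` elsewhere, so (D) and (M) hold on windows
`[b^{θ_k}/R, b^{θ_k} R]` for all large `b`: in the tropical limit the real count of the pencil is EXACTLY the design's alternation
count (the tree has the lower half, `le_card_posRoots_patch`).  Hence every real EXCESS over a tropical count (Li–Wang-type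
phenomena, the census row (2,4): 9 > 8) lives at finite base, inside merged windows — the object a lifting lemma must control.
The design-level corollary (verifying (D), (M) from dominance margins of a design) is NOT in this file.
[folklore] (one-variable patchworking with explicit margins; no single source).
-/

set_option linter.dupNamespace false
set_option autoImplicit false

namespace Summit.ValiantsHypothesis.ValiantsHypothesis.Theorems.KPlusLogSqLaw.ExactPatchwork

open Polynomial Finset
open scoped BigOperators

/-! ## Assembly: every positive zero sits in an alternating window, at most one per window -/

/-- **Localisation.** Under the Newton-polygon margin hypotheses (vertex chain `v`, windows `[p_k, q_k]`), every positive zero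
of `f` lies in one of the windows `[p_k, q_k]`. [folklore] -/
theorem exists_window_of_eval_eq_zero (f : ℝ[X]) (r : ℕ) (v : Fin (r + 1) → ℕ) (p q : Fin r → ℝ)
    (hvs : ∀ i, v i ∈ f.support)
    (hmin : ∀ s ∈ f.support, v 0 ≤ s) (hmax : ∀ s ∈ f.support, s ≤ v (Fin.last r))
    (hp : ∀ k, 0 < p k) (hpq : ∀ k, p k ≤ q k)
    (hDl : ∀ k : Fin r, ∑ s ∈ f.support.erase (v k.castSucc), |f.coeff s| * p k ^ s
      < |f.coeff (v k.castSucc)| * p k ^ v k.castSucc)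
    (hDr : ∀ k : Fin r, ∑ s ∈ f.support.erase (v k.succ), |f.coeff s| * q k ^ s
      < |f.coeff (v k.succ)| * q k ^ v k.succ)
    {t : ℝ} (ht : 0 < t) (hroot : f.eval t = 0) : ∃ k : Fin r, t ∈ Set.Icc (p k) (q k) := by
  classical
  by_contra hcon
  push Not at hcon
  -- it suffices to exhibit a dominant vertex at `t`
  suffices hdom : ∃ w : ℕ, ∑ s ∈ f.support.erase w, |f.coeff s| * t ^ s < |f.coeff w| * t ^ w by
    obtain ⟨w, hw⟩ := hdom
    have := mul_eval_pos_of_dominant f ht hw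
    rw [hroot, mul_zero] at this
    exact lt_irrefl _ this
  have hc0 : ∀ s : ℕ, 0 ≤ |f.coeff s| := fun s => abs_nonneg _
  rcases Nat.eq_zero_or_pos r with hr | hr
  · -- no window: `f` is a monomial `a · X^(v 0)`
    subst hr
    refine ⟨v 0, ?_⟩
    have hsupp : f.support.erase (v 0) = ∅ := by
      refine Finset.eq_empty_of_forall_notMem fun s hs => ?_
      obtain ⟨hne, hs'⟩ := Finset.mem_erase.mp hs
      exact hne (le_antisymm (by simpa using hmax s hs') (hmin s hs'))
    rw [hsupp, Finset.sum_empty]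
    exact mul_pos (abs_pos.mpr (Polynomial.mem_support_iff.mp (hvs 0))) (pow_pos ht _)
  · set F : Finset (Fin r) := Finset.univ.filter (fun k : Fin r => q k < t) with hF
    rcases Finset.eq_empty_or_nonempty F with hFe | hFne
    · -- below the first window: the minimal vertex dominates
      set k₀ : Fin r := ⟨0, hr⟩ with hk₀
      have htq : t ≤ q k₀ := by
        by_contra h
        push Not at h
        have : k₀ ∈ F := by rw [hF]; exact Finset.mem_filter.mpr ⟨Finset.mem_univ _, h⟩
        rw [hFe] at this; exact absurd this (Finset.notMem_empty _)
      have htp : t < p k₀ := by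
        by_contra h
        push Not at h
        exact hcon k₀ ⟨h, htq⟩
      have hcast : k₀.castSucc = (0 : Fin (r + 1)) := Fin.ext (by simp [hk₀])
      refine ⟨v 0, ?_⟩
      have hD := hDl k₀
      rw [hcast] at hD
      exact sum_mul_pow_lt_of_le_of_forall_le (f.support.erase (v 0)) (fun s => |f.coeff s|) hc0 (v 0)
        (fun s hs => hmin s (Finset.mem_of_mem_erase hs)) ht htp.le hD
    · set k₁ : Fin r := F.max' hFne with hk₁
      have hk₁F : k₁ ∈ F := Finset.max'_mem F hFne
      have hqt : q k₁ < t := (Finset.mem_filter.mp hk₁F).2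
      by_cases hlast : (k₁ : ℕ) + 1 < r
      · -- between windows `k₁` and `k₁ + 1`: the common vertex dominates
        set k₂ : Fin r := ⟨(k₁ : ℕ) + 1, hlast⟩ with hk₂
        have htq : t ≤ q k₂ := by
          by_contra h
          push Not at h
          have hk₂F : k₂ ∈ F := by rw [hF]; exact Finset.mem_filter.mpr ⟨Finset.mem_univ _, h⟩
          have : k₂ ≤ k₁ := Finset.le_max' F k₂ hk₂F
          have : (k₁ : ℕ) + 1 ≤ k₁ := this
          omega
        have htp : t < p k₂ := by
          by_contra h
          push Not at h
          exact hcon k₂ ⟨h, htq⟩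
        have hsc : k₁.succ = k₂.castSucc := Fin.ext (by simp [hk₂])
        refine ⟨v k₂.castSucc, ?_⟩
        have hD1 := hDr k₁
        rw [hsc] at hD1
        exact sum_mul_pow_lt_of_endpoints (f.support.erase (v k₂.castSucc)) (fun s => |f.coeff s|) hc0 _
          (lt_of_lt_of_le (hp k₁) (hpq k₁)) hqt.le htp.le hD1 (hDl k₂)
      · -- above the last window: the maximal vertex dominates
        have hsc : k₁.succ = Fin.last r := Fin.ext (by simp; omega)
        refine ⟨v (Fin.last r), ?_⟩
        have hD1 := hDr k₁
        rw [hsc] at hD1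
        exact sum_mul_pow_lt_of_ge_of_forall_ge (f.support.erase (v (Fin.last r))) (fun s => |f.coeff s|) hc0 _
          (fun s hs => hmax s (Finset.mem_of_mem_erase hs)) (lt_of_lt_of_le (hp k₁) (hpq k₁)) hqt.le hD1


/-- **EXACT ARCHIMEDEAN NEWTON-POLYGON COUNT (upper half).**  Let `f` be a real polynomial, `v₀ < v₁ < ⋯ < v_r` exponents
of `f` with `v₀` minimal and `v_r` maximal in the support, and `0 < p_k ≤ q_k` (`k < r`) windows such that
(D) at `p_k` the vertex `v_k` and at `q_k` the vertex `v_{k+1}` beats the sum of the absolute values of all other terms, and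
(M) at both `p_k` and `q_k` the term `v_{k+1}` beats the `|s − v_k| / (v_{k+1} − v_k)`-weighted sum of the terms
`s ∉ {v_k, v_{k+1}}`.  Then the number of distinct positive zeros of `f` is at most the number of SIGN-ALTERNATING windows
`#{k : a_{v_k} a_{v_{k+1}} < 0}` — the patchwork (Viro) count of the vertex chain.  Proof: dominance regions are zero-free
(convexity in `log x` reduces them to their endpoints), each window carries at most one zero (`f / x^{v_k}` is strictly
monotone there) and none unless its edge alternates. [folklore] -/
theorem card_posRoots_le_card_alternating (f : ℝ[X]) (r : ℕ) (v : Fin (r + 1) → ℕ) (p q : Fin r → ℝ)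
    (hv : StrictMono v) (hvs : ∀ i, v i ∈ f.support)
    (hmin : ∀ s ∈ f.support, v 0 ≤ s) (hmax : ∀ s ∈ f.support, s ≤ v (Fin.last r))
    (hp : ∀ k, 0 < p k) (hpq : ∀ k, p k ≤ q k)
    (hDl : ∀ k : Fin r, ∑ s ∈ f.support.erase (v k.castSucc), |f.coeff s| * p k ^ s
      < |f.coeff (v k.castSucc)| * p k ^ v k.castSucc)
    (hDr : ∀ k : Fin r, ∑ s ∈ f.support.erase (v k.succ), |f.coeff s| * q k ^ s
      < |f.coeff (v k.succ)| * q k ^ v k.succ)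
    (hMl : ∀ k : Fin r, ∑ s ∈ (f.support.erase (v k.castSucc)).erase (v k.succ),
      |(s : ℝ) - v k.castSucc| * |f.coeff s| * p k ^ s
        < ((v k.succ : ℝ) - v k.castSucc) * |f.coeff (v k.succ)| * p k ^ v k.succ)
    (hMr : ∀ k : Fin r, ∑ s ∈ (f.support.erase (v k.castSucc)).erase (v k.succ),
      |(s : ℝ) - v k.castSucc| * |f.coeff s| * q k ^ s
        < ((v k.succ : ℝ) - v k.castSucc) * |f.coeff (v k.succ)| * q k ^ v k.succ) :
    (f.roots.toFinset.filter (fun t => 0 < t)).card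
      ≤ (Finset.univ.filter (fun k : Fin r => f.coeff (v k.castSucc) * f.coeff (v k.succ) < 0)).card := by
  classical
  have hf0 : f ≠ 0 := by
    intro h
    have := hvs 0
    rw [h, Polynomial.support_zero] at this
    exact absurd this (Finset.notMem_empty _)
  have hmem : ∀ t ∈ f.roots.toFinset.filter (fun t => 0 < t), 0 < t ∧ f.eval t = 0 := by
    intro t ht
    rw [Finset.mem_filter, Multiset.mem_toFinset, Polynomial.mem_roots hf0, Polynomial.IsRoot.def] at ht
    exact ⟨ht.2, ht.1⟩
  have hwin : ∀ t ∈ f.roots.toFinset.filter (fun t => 0 < t), ∃ k : Fin r, t ∈ Set.Icc (p k) (q k) := by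
    intro t ht
    obtain ⟨ht0, hr⟩ := hmem t ht
    exact exists_window_of_eval_eq_zero f r v p q hvs hmin hmax hp hpq hDl hDr ht0 hr
  rcases Nat.eq_zero_or_pos r with hr | hr
  · -- no window at all: there is no positive zero
    subst hr
    have : f.roots.toFinset.filter (fun t => 0 < t) = ∅ := by
      refine Finset.eq_empty_of_forall_notMem fun t ht => ?_
      obtain ⟨k, _⟩ := hwin t ht
      exact k.elim0
    rw [this, Finset.card_empty]
    exact Nat.zero_le _
  haveI : Nonempty (Fin r) := ⟨⟨0, hr⟩⟩
  choose! κ hκ using hwin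
  refine Finset.card_le_card_of_injOn κ (fun t ht => ?_) ?_
  · -- the window of a zero is alternating
    have ht' : t ∈ f.roots.toFinset.filter (fun t => 0 < t) := by simpa using ht
    have hk := hκ t ht'
    obtain ⟨_, hr⟩ := hmem t ht'
    simp only [Finset.coe_filter, Finset.mem_univ, true_and, Set.mem_setOf_eq]
    by_contra hge
    push Not at hge
    have hne : f.coeff (v (κ t).castSucc) * f.coeff (v (κ t).succ) ≠ 0 :=
      mul_ne_zero (Polynomial.mem_support_iff.mp (hvs _)) (Polynomial.mem_support_iff.mp (hvs _))
    have hpos : 0 < f.coeff (v (κ t).castSucc) * f.coeff (v (κ t).succ) := lt_of_le_of_ne hge hne.symm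
    exact eval_ne_zero_of_mem_window_of_pos f (hv Fin.castSucc_lt_succ) (hvs _) (hp _) (hpq _) (hDl _)
      (hMl _) (hMr _) hpos hk hr
  · intro t₁ ht₁ t₂ ht₂ heq
    have ht₁' : t₁ ∈ f.roots.toFinset.filter (fun t => 0 < t) := by simpa using ht₁
    have ht₂' : t₂ ∈ f.roots.toFinset.filter (fun t => 0 < t) := by simpa using ht₂
    have hk₁ := hκ t₁ ht₁'
    have hk₂ := hκ t₂ ht₂'
    obtain ⟨_, hr₁⟩ := hmem t₁ ht₁'
    obtain ⟨_, hr₂⟩ := hmem t₂ ht₂'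
    rw [heq] at hk₁
    exact eq_of_isRoot_of_mem_window f (hv Fin.castSucc_lt_succ) (hvs _) (hp _) (hMl _) (hMr _)
      hk₁ hk₂ hr₁ hr₂


/-- **EXACT ARCHIMEDEAN NEWTON-POLYGON COUNT (lower half).** With the windows ordered (`q_k ≤ p_{k'}` for `k < k'`) and
the dominance hypotheses (D), every sign-alternating window carries its own positive zero, so the number of distinct positive
zeros is at least `#{k : a_{v_k} a_{v_{k+1}} < 0}` (the tree's `le_card_posRoots_of_alternating` in Newton-polygon dress;
no margin hypothesis (M) is needed for this half). [folklore] -/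
theorem card_alternating_le_card_posRoots (f : ℝ[X]) (r : ℕ) (v : Fin (r + 1) → ℕ) (p q : Fin r → ℝ)
    (hp : ∀ k, 0 < p k) (hpq : ∀ k, p k ≤ q k) (hqp : ∀ k k' : Fin r, k < k' → q k ≤ p k')
    (hDl : ∀ k : Fin r, ∑ s ∈ f.support.erase (v k.castSucc), |f.coeff s| * p k ^ s
      < |f.coeff (v k.castSucc)| * p k ^ v k.castSucc)
    (hDr : ∀ k : Fin r, ∑ s ∈ f.support.erase (v k.succ), |f.coeff s| * q k ^ s
      < |f.coeff (v k.succ)| * q k ^ v k.succ) :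
    (Finset.univ.filter (fun k : Fin r => f.coeff (v k.castSucc) * f.coeff (v k.succ) < 0)).card
      ≤ (f.roots.toFinset.filter (fun t => 0 < t)).card := by
  classical
  rcases Nat.eq_zero_or_pos r with hr | hr
  · subst hr
    rw [Finset.univ_eq_empty, Finset.filter_empty, Finset.card_empty]
    exact Nat.zero_le _
  have hf0 : f ≠ 0 := by
    intro h
    have := hDl ⟨0, hr⟩
    simp [h] at this
  have hroot : ∀ k ∈ Finset.univ.filter (fun k : Fin r => f.coeff (v k.castSucc) * f.coeff (v k.succ) < 0),
      ∃ y ∈ Set.Ioo (p k) (q k), f.eval y = 0 := by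
    intro k hk
    exact exists_root_of_alternating_window f (hp k) (hpq k) (hDl k) (hDr k) (Finset.mem_filter.mp hk).2
  haveI : Nonempty (Fin r) := ⟨⟨0, hr⟩⟩
  choose! ρ hρ using hroot
  refine Finset.card_le_card_of_injOn ρ (fun k hk => ?_) ?_
  · have hk' : k ∈ Finset.univ.filter (fun k : Fin r => f.coeff (v k.castSucc) * f.coeff (v k.succ) < 0) := by
      simpa using hk
    obtain ⟨hy, hy0⟩ := hρ k hk'
    simp only [Finset.coe_filter, Set.mem_setOf_eq, Multiset.mem_toFinset, Polynomial.mem_roots hf0,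
      Polynomial.IsRoot.def]
    exact ⟨hy0, lt_trans (hp k) hy.1⟩
  · intro k₁ hk₁ k₂ hk₂ heq
    have hk₁' : k₁ ∈ Finset.univ.filter (fun k : Fin r => f.coeff (v k.castSucc) * f.coeff (v k.succ) < 0) := by
      simpa using hk₁
    have hk₂' : k₂ ∈ Finset.univ.filter (fun k : Fin r => f.coeff (v k.castSucc) * f.coeff (v k.succ) < 0) := by
      simpa using hk₂
    obtain ⟨hy₁, -⟩ := hρ k₁ hk₁'
    obtain ⟨hy₂, -⟩ := hρ k₂ hk₂'
    by_contra hne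
    rcases lt_or_gt_of_ne hne with hlt | hlt
    · have := hqp k₁ k₂ hlt
      have : ρ k₁ < ρ k₂ := lt_of_lt_of_le hy₁.2 (this.trans hy₂.1.le)
      rw [heq] at this; exact lt_irrefl _ this
    · have := hqp k₂ k₁ hlt
      have : ρ k₂ < ρ k₁ := lt_of_lt_of_le hy₂.2 (this.trans hy₁.1.le)
      rw [heq] at this; exact lt_irrefl _ this

/-- **EXACT ARCHIMEDEAN NEWTON-POLYGON COUNT.**  Under (D) and (M) on ordered windows along a vertex chain spanning the support,
the number of distinct positive zeros of `f` EQUALS the number of sign-alternating edges of the chain.  For the patchworked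
pencils of a tropical design (`patchMatrix`, base `b → ∞`) with unique envelope vertices these hypotheses hold for all large
`b` (margins grow like powers of `b`), which is the sense in which this is the two-sided, pencil-level form of
`MatrixDescartes.Negative.le_card_posRoots_patch`: in the tropical limit the real count is EXACTLY the tropical one, so every
real excess over a design's alternation count lives at finite base. [folklore] -/
theorem card_posRoots_eq_card_alternating (f : ℝ[X]) (r : ℕ) (v : Fin (r + 1) → ℕ) (p q : Fin r → ℝ)
    (hv : StrictMono v) (hvs : ∀ i, v i ∈ f.support)
    (hmin : ∀ s ∈ f.support, v 0 ≤ s) (hmax : ∀ s ∈ f.support, s ≤ v (Fin.last r))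
    (hp : ∀ k, 0 < p k) (hpq : ∀ k, p k ≤ q k) (hqp : ∀ k k' : Fin r, k < k' → q k ≤ p k')
    (hDl : ∀ k : Fin r, ∑ s ∈ f.support.erase (v k.castSucc), |f.coeff s| * p k ^ s
      < |f.coeff (v k.castSucc)| * p k ^ v k.castSucc)
    (hDr : ∀ k : Fin r, ∑ s ∈ f.support.erase (v k.succ), |f.coeff s| * q k ^ s
      < |f.coeff (v k.succ)| * q k ^ v k.succ)
    (hMl : ∀ k : Fin r, ∑ s ∈ (f.support.erase (v k.castSucc)).erase (v k.succ),
      |(s : ℝ) - v k.castSucc| * |f.coeff s| * p k ^ s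
        < ((v k.succ : ℝ) - v k.castSucc) * |f.coeff (v k.succ)| * p k ^ v k.succ)
    (hMr : ∀ k : Fin r, ∑ s ∈ (f.support.erase (v k.castSucc)).erase (v k.succ),
      |(s : ℝ) - v k.castSucc| * |f.coeff s| * q k ^ s
        < ((v k.succ : ℝ) - v k.castSucc) * |f.coeff (v k.succ)| * q k ^ v k.succ) :
    (f.roots.toFinset.filter (fun t => 0 < t)).card
      = (Finset.univ.filter (fun k : Fin r => f.coeff (v k.castSucc) * f.coeff (v k.succ) < 0)).card :=
  le_antisymm (card_posRoots_le_card_alternating f r v p q hv hvs hmin hmax hp hpq hDl hDr hMl hMr)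
    (card_alternating_le_card_posRoots f r v p q hp hpq hqp hDl hDr)

end Summit.ValiantsHypothesis.ValiantsHypothesis.Theorems.KPlusLogSqLaw.ExactPatchwork
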